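import Summits.KontsevichZagierPeriods.Zeta5Search.LaiSweepShard

/-!
# `κ₃` sweep certificate — shard file 056 of 127 (shards 392–398 of 889)

HONEST FRAMING. Systematic search; no irrationality claim unless certified. This file only checks,
by `decide +kernel`, shards 392–398 of the order-cell sweep of the `κ₃` point `(74, 2180, 444; δ74)`
(engine `LaiSweepEngine`, soundness `LaiSweepJump/Free/Eval/Shard/Kappa3`; a shard is `⟨regime, n,
p, q, p', q', Lo, Up⟩`: `n` cells from `p/q` to `p'/q'` with integer rate sums in `[Lo, Up]`, `K =
128`, `D = 2^40`). It draws NO conclusion: only the capstone `LaiKappa3SweepCert`, which needs all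
127 shard files, does. Kernel cost of this file ≈ 560 cells × 0.3 s.
-/

namespace Summit.KontsevichZagierPeriods.Zeta5Search.Sweep

set_option maxHeartbeats 100000000 in
/-- Shard 392: 80 cells of regime B from `152/405` to `137/364`.
[cite: Lai2024BallRivoal, §4 Lemma 4.3] -/
theorem shard392 :
    Shard.check 128 (2^40)
      ⟨true, 80, 152, 405, 137, 364, 15854270295938, 17725099429244⟩ = true := by
  decide +kernel

set_option maxHeartbeats 100000000 in
/-- Shard 393: 80 cells of regime B from `137/364` to `54/143`.
[cite: Lai2024BallRivoal, §4 Lemma 4.3] -/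
theorem shard393 :
    Shard.check 128 (2^40)
      ⟨true, 80, 137, 364, 54, 143, 18561112553267, 20766415940817⟩ = true := by
  decide +kernel

set_option maxHeartbeats 100000000 in
/-- Shard 394: 80 cells of regime B from `54/143` to `61/161`.
[cite: Lai2024BallRivoal, §4 Lemma 4.3] -/
theorem shard394 :
    Shard.check 128 (2^40)
      ⟨true, 80, 54, 143, 61, 161, 18672881896185, 20907797669640⟩ = true := by
  decide +kernel

set_option maxHeartbeats 100000000 in
/-- Shard 395: 80 cells of regime B from `61/161` to `157/413`.
[cite: Lai2024BallRivoal, §4 Lemma 4.3] -/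
theorem shard395 :
    Shard.check 128 (2^40)
      ⟨true, 80, 61, 161, 157, 413, 18686518737828, 20939505800333⟩ = true := by
  decide +kernel

set_option maxHeartbeats 100000000 in
/-- Shard 396: 80 cells of regime B from `157/413` to `127/333`.
[cite: Lai2024BallRivoal, §4 Lemma 4.3] -/
theorem shard396 :
    Shard.check 128 (2^40)
      ⟨true, 80, 157, 413, 127, 333, 18226582745297, 20440219569412⟩ = true := by
  decide +kernel

set_option maxHeartbeats 100000000 in
/-- Shard 397: 80 cells of regime B from `127/333` to `163/426`.
[cite: Lai2024BallRivoal, §4 Lemma 4.3] -/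
theorem shard397 :
    Shard.check 128 (2^40)
      ⟨true, 80, 127, 333, 163, 426, 18346213094105, 20590018994876⟩ = true := by
  decide +kernel

set_option maxHeartbeats 100000000 in
/-- Shard 398: 80 cells of regime B from `163/426` to `81/211`.
[cite: Lai2024BallRivoal, §4 Lemma 4.3] -/
theorem shard398 :
    Shard.check 128 (2^40)
      ⟨true, 80, 163, 426, 81, 211, 18435794314772, 20706725337211⟩ = true := by
  decide +kernel

/-- The checked shards of this file, in order. [folklore] -/
def shards056 : List (CheckedShard 128 (2^40)) :=
  [⟨_, shard392⟩, ⟨_, shard393⟩, ⟨_, shard394⟩, ⟨_, shard395⟩, ⟨_, shard396⟩,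
    ⟨_, shard397⟩, ⟨_, shard398⟩]

end Summit.KontsevichZagierPeriods.Zeta5Search.Sweep
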